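import Summits.CriticalPhenomena.PercolationContinuityZ3.Theorems.PercNearOneGluingNoHeavyQuantThreeChainPieces
import HarnessLib

/-!
# QUANT lane R8, T-DEC: THREE 3-CHAINS `R[qᵢ](R[pᵢ](R[sᵢ]))` ARE SDEC AT THE TRUE FLOOR, ORACLE-FREE — the minimal open FAMILY of the sibling
# step's residue (all `mᵢ = qᵢ(1+pᵢ+pᵢsᵢ) ≥ 2`, every floor `x ≤ min qᵢpᵢsᵢ`), by the piece expansion with the light piece peeled by HIGH-CONV

builds on p205010 (kernel theorem, internal audit signed; external expert review pending)

Support file (`--supports stmt-CriticalPhenomena-4575`), QUANT lane seat prim-quant-census-1 (gen 30); memo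
`run/shared/lean/prim/quant/prim-quant-census-1/g30/SUBFLOOR-HUBS-G30.md` §3 (4).  Theorems only (standard axioms, no sorries): the width-3
ASSEMBLY for 3-chains over `…QuantThreeChainPieces` (this seat: the three-piece mixture `gate_chain3_eq_mix`, `isHigh_hp`, `sdec_chain3`), the
three cores `sdec_farPieceBlob` ✓ p555663, `sdec_pairHub` ✓ p553983, `sdec_tripleHub` ✓ p554973, the glued-children tools `sdec_mix_laws` /
`sdec_blob3_step` ✓ p557095, and arm-1 g57's HIGH-CONV `sdec_lconv_high` ✓ p548056.

WHY (README V393 → RATE-PLAN §58.4).  The node's first minimal family was three 2-chains (closed by arm-1 g55/g56 and census-1 g29); after COMP-SLICE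
and HIGH-CONV the residue is the heavy-unfloored corner, whose smallest family is THREE 3-CHAINS at the true floor (tops 3; the glued child is its
`s = 1` face, ✓ `sdec_gluedChildren3`); census-1 g29's hull+high certificate `hullHigh_chain3` fails exactly in its near-sure corner.  This file
closes the family for all parameters with `mᵢ ≥ 2` (the heavy case; `mᵢ ≤ 2` siblings are tame and ride arm-1's `sdec_cons_of_tame` on the binder).
THE PROOF.  Expand each sibling into blob / far-giant piece / light piece; per term: heavy blobs are slices (`sdec_blob3_step`), light pieces are
HIGH and peel by `sdec_lconv_high`, and what remains is one of: `C ∗ blob₃` (`sdec_farPieceBlob`), `C ∗ H` (HIGH, `isHigh_farPieceHp`), the pair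
hub, the triple hub; all terms have mean `Σ mᵢ` (`sdec_mix_laws`).  Organised as: `chain3_floor`; **`sdec_farPiece_chain`** (`C(γ) ∗ t`);
**`sdec_chains2`** (`t₂ ∗ t₁`, TWO 3-chains, every floor); **`sdec_pairHub_chain`** (`(C∗C) ∗ t`); **`sdec_farPiece_chains2`** (`C ∗ (t₂ ∗ t₁)`);
**`sdec_chains3`**: for all `0 < qᵢ,pᵢ,sᵢ < 1` with `qᵢ(1+pᵢ+pᵢsᵢ) ≥ 2` and every `0 < x ≤ min qᵢpᵢsᵢ`: `SDEC x 9 (t₃ ∗ t₂ ∗ t₁)` with its law facts.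
HONEST STATUS.  One family (9 parameters + the floor) of the residue, unconditionally; the k-general sibling step is OPEN (`SiblingStep` ⟺
`GateStepN`, `FarTreeRow`); RATE class (log\*) / honest sentence of `run/shared/lean/prim/quant/README.md` unchanged.  [this work].  Nothing here is
cited as a published result.  The gluing rows served [cite: KozmaNitzan2024, Conjecture 3 (p. 15)]; product measure [cite: Grimmett1999, §1.3 p. 10].
-/

noncomputable section

open scoped BigOperators

namespace Summit.CriticalPhenomena.PercolationContinuityZ3.Theorems
namespace Quant
namespace LawDec

open Finset

/-- the point mass `δ_K` -/
local notation3 "δ[" K "]" => (fun k : ℕ => if k = (K : ℕ) then (1 : ℝ) else 0)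

/-- the law `{1, 3; a}` (glued pair under a sure relay / far-giant piece) -/
local notation3 "CP[" a "]" => (fun h : ℕ => (1 - (a : ℝ)) * (if h = 1 then (1 : ℝ) else 0) + (a : ℝ) * (if h = 3 then (1 : ℝ) else 0))

/-- the LIGHT PIECE `{2, 3; θ}` of a gated 3-chain: two sure relays over a 1-blob -/
local notation3 "HP[" a "]" => (fun h : ℕ => (1 - (a : ℝ)) * (if h = 2 then (1 : ℝ) else 0) + (a : ℝ) * (if h = 3 then (1 : ℝ) else 0))

/-- the 3-chain's sub-forest law `{1: 1−p, 2: p(1−s), 3: ps}` (`R[p](R[s])` under a sure relay) -/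
local notation3 "CH[" p ", " s "]" => (fun h : ℕ => (1 - (p : ℝ)) * (if h = 1 then (1 : ℝ) else 0) +
  (p : ℝ) * (1 - (s : ℝ)) * (if h = 2 then (1 : ℝ) else 0) + (p : ℝ) * (s : ℝ) * (if h = 3 then (1 : ℝ) else 0))

/-- the SUB-FLOOR PART of a gated 3-chain (`m = q(1+p+ps)`): the same-mean mixture `β′·C((m−1)/2) + δ′·H(m−2)`,
`β′ = 2(1−p)/(2−p−ps)`, `δ′ = p(1−s)/(2−p−ps)` -/
local notation3 "NP[" q ", " p ", " s "]" => (fun h : ℕ =>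
  2 * (1 - (p : ℝ)) / (2 - p - p * s) * CP[((q : ℝ) * (1 + p + p * s) - 1) / 2] h +
  (p : ℝ) * (1 - s) / (2 - p - p * s) * HP[(q : ℝ) * (1 + p + p * s) - 2] h)

/-! ### Floors -/

/-- floor facts of a 3-chain with `m = q(1+p+ps) ≥ 2` at a floor `0 < x ≤ qps`: `x < 1`, `3x ≤ m`, and the forms used by the cores. [this work] -/
theorem chain3_floor {x q p s : ℝ} (hq0 : 0 < q) (hq1 : q < 1) (hp0 : 0 < p) (hp1 : p ≤ 1) (_hs0 : 0 < s) (hs1 : s ≤ 1)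
    (hx : x ≤ q * (p * s)) :
    x < 1 ∧ 3 * x ≤ q * (1 + p + p * s) ∧ x ≤ q * (1 + p + p * s) / 3 ∧ 3 * x ≤ 1 + 2 * ((q * (1 + p + p * s) - 1) / 2) ∧
      3 * x ≤ 2 + (q * (1 + p + p * s) - 2) := by
  have hps1 : p * s ≤ 1 := by nlinarith
  have hpsp : p * s ≤ p := by nlinarith
  have h1 : q * (p * s) < 1 := by nlinarith
  have h3 : q * (p * s) * 3 ≤ q * (1 + p + p * s) := by nlinarith [mul_le_mul_of_nonneg_left hpsp hq0.le]
  refine ⟨by linarith, by linarith, by linarith, by linarith, by linarith⟩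

/-! ### The far-giant piece beside a 3-chain -/

/-- **`C(γ) ∗ t` for a gated 3-chain `t` is SDEC** at every floor `0 < x ≤ qps` with `3x ≤ 1 + 2γ`, `1/2 ≤ γ < 1` (`m ≥ 2`, `s < 1`): the mixture of
`C ∗ blob₃(m/3)` (`sdec_farPieceBlob`), the pair hub `C(γ) ∗ C((m−1)/2)` and the HIGH law `C(γ) ∗ H(m−2)`; with law facts. [this work] -/
theorem sdec_farPiece_chain {x c q p s : ℝ} (hx0 : 0 < x) (hc : 1 / 2 ≤ c) (hc1 : c < 1) (hxc : 3 * x ≤ 1 + 2 * c)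
    (hq0 : 0 < q) (hq1 : q < 1) (hp0 : 0 < p) (hp1 : p < 1) (hs0 : 0 < s) (hs1 : s < 1) (hm : 2 ≤ q * (1 + p + p * s))
    (hx : x ≤ q * (p * s)) :
    (∀ h, 0 ≤ lconv 3 3 CP[c] (gate CH[p, s] q) h) ∧ (∀ h, 3 + 3 < h → lconv 3 3 CP[c] (gate CH[p, s] q) h = 0) ∧
      ∑ h ∈ Finset.range (3 + 3 + 1), lconv 3 3 CP[c] (gate CH[p, s] q) h = 1 ∧
      ∑ h ∈ Finset.range (3 + 3 + 1), (h : ℝ) * lconv 3 3 CP[c] (gate CH[p, s] q) h = (1 + 2 * c) + q * (1 + p + p * s) ∧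
      SDEC x (3 + 3) (lconv 3 3 CP[c] (gate CH[p, s] q)) := by
  obtain ⟨_, _, α0, α1, β0, β1, bd, s0, s1, γ0, γ1, θ0, θ1⟩ := chain3_params hq0 hq1 hp0 hp1 hs0 hs1.le hm
  obtain ⟨hx1, hxm, hxs, hxγ, hxθ⟩ := chain3_floor hq0 hq1 hp0 hp1.le hs0 hs1.le hx
  obtain ⟨c0, cM, c1, cmean⟩ := cp_laws (show (0 : ℝ) ≤ c by linarith) hc1.le
  -- the three components
  obtain ⟨e0, _, e1, emean⟩ := blob3_laws (show (0 : ℝ) ≤ q * (1 + p + p * s) / 3 by linarith) s1.le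
  have hB : SDEC x (3 + 3) (lconv 3 3 CP[c] (gate δ[3] (q * (1 + p + p * s) / 3))) := by
    rw [farPieceBlob_eq_lconv]; exact sdec_farPieceBlob hx0 hc hc1 s0 s1 hxs hxc
  obtain ⟨B0, BM, B1, Bmean⟩ := lconv_laws c0 c1 cmean e0 e1 emean
  obtain ⟨f0, _, f1, fmean⟩ := cp_laws (show (0 : ℝ) ≤ (q * (1 + p + p * s) - 1) / 2 by linarith) γ1.le
  have hC : SDEC x (3 + 3) (lconv 3 3 CP[c] CP[(q * (1 + p + p * s) - 1) / 2]) := by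
    rw [pairHub_eq_lconv]; exact sdec_pairHub hx0 hx1 hc hc1 γ0 γ1 hxc hxγ
  obtain ⟨C0, CM, C1, Cmean⟩ := lconv_laws c0 c1 cmean f0 f1 fmean
  obtain ⟨g0, _, g1, gmean⟩ := hp_laws θ0 θ1
  have hHi : IsHigh x ((1 + 2 * c) + (2 + (q * (1 + p + p * s) - 2))) (3 + 3) (lconv 3 3 CP[c] HP[q * (1 + p + p * s) - 2]) :=
    isHigh_farPieceHp (by linarith) hc1.le θ0 θ1 (by linarith)
  have hH : SDEC x (3 + 3) (lconv 3 3 CP[c] HP[q * (1 + p + p * s) - 2]) := isHigh_sdec hx0 hx1 hHi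
  obtain ⟨H0, HM, H1, Hmean⟩ := lconv_laws c0 c1 cmean g0 g1 gmean
  -- means
  have eB : (1 + 2 * c) + 3 * (q * (1 + p + p * s) / 3) = (1 + 2 * c) + q * (1 + p + p * s) := by ring
  have eC : (1 + 2 * c) + (1 + 2 * ((q * (1 + p + p * s) - 1) / 2)) = (1 + 2 * c) + q * (1 + p + p * s) := by ring
  have eH : (1 + 2 * c) + (2 + (q * (1 + p + p * s) - 2)) = (1 + 2 * c) + q * (1 + p + p * s) := by ring
  rw [eB] at Bmean; rw [eC] at Cmean; rw [eH] at Hmean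
  -- the sub-floor part `C ∗ N = β′ (C ∗ C_b) + (1−β′) (C ∗ H_b)`
  have hN : ∀ h, lconv 3 3 CP[c] NP[q, p, s] h = 2 * (1 - p) / (2 - p - p * s) * lconv 3 3 CP[c] CP[(q * (1 + p + p * s) - 1) / 2] h +
      (1 - 2 * (1 - p) / (2 - p - p * s)) * lconv 3 3 CP[c] HP[q * (1 + p + p * s) - 2] h := by
    intro h; rw [bd]; exact lconv_lin_right 3 3 _ _ CP[c] _ _ h
  obtain ⟨N0, NM, N1, Nmean, hNs⟩ := sdec_mix_laws β0 β1 hN C0 CM C1 Cmean H0 HM H1 Hmean hC hH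
  -- the outer mixture over the blob
  exact sdec_mix_laws α0 α1 (fun h => lconv_mix_right 3 3 CP[c] _ _ _ _ (gate_chain3_eq_mix hq0 hq1 hp0 hp1 hs0.le hs1.le) h)
    B0 BM B1 Bmean N0 NM N1 Nmean hB hNs

/-! ### Two 3-chains -/

/-- **TWO 3-CHAINS: `t_b ∗ t_a` is SDEC at every floor `0 < x ≤ min qᵢpᵢsᵢ`** (`mᵢ ≥ 2`, `sᵢ < 1`), with law facts.  Oracle-free. [this work] -/
theorem sdec_chains2 {x q₁ p₁ s₁ q₂ p₂ s₂ : ℝ} (hx0 : 0 < x)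
    (hq₁ : 0 < q₁) (hq₁' : q₁ < 1) (hp₁ : 0 < p₁) (hp₁' : p₁ < 1) (hs₁ : 0 < s₁) (hs₁' : s₁ < 1) (hm₁ : 2 ≤ q₁ * (1 + p₁ + p₁ * s₁))
    (hq₂ : 0 < q₂) (hq₂' : q₂ < 1) (hp₂ : 0 < p₂) (hp₂' : p₂ < 1) (hs₂ : 0 < s₂) (hs₂' : s₂ < 1) (hm₂ : 2 ≤ q₂ * (1 + p₂ + p₂ * s₂))
    (hx₁ : x ≤ q₁ * (p₁ * s₁)) (hx₂ : x ≤ q₂ * (p₂ * s₂)) :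
    (∀ h, 0 ≤ lconv 3 3 (gate CH[p₂, s₂] q₂) (gate CH[p₁, s₁] q₁) h) ∧
    (∀ h, 3 + 3 < h → lconv 3 3 (gate CH[p₂, s₂] q₂) (gate CH[p₁, s₁] q₁) h = 0) ∧
      ∑ h ∈ Finset.range (3 + 3 + 1), lconv 3 3 (gate CH[p₂, s₂] q₂) (gate CH[p₁, s₁] q₁) h = 1 ∧
      ∑ h ∈ Finset.range (3 + 3 + 1), (h : ℝ) * lconv 3 3 (gate CH[p₂, s₂] q₂) (gate CH[p₁, s₁] q₁) h =
        q₂ * (1 + p₂ + p₂ * s₂) + q₁ * (1 + p₁ + p₁ * s₁) ∧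
      SDEC x (3 + 3) (lconv 3 3 (gate CH[p₂, s₂] q₂) (gate CH[p₁, s₁] q₁)) := by
  obtain ⟨_, _, α0, α1, β0, β1, bd, s0, s1, γ0, γ1, θ0, θ1⟩ := chain3_params hq₁ hq₁' hp₁ hp₁' hs₁ hs₁'.le hm₁
  obtain ⟨hx1, hxm₁, hxs₁, hxγ₁, hxθ₁⟩ := chain3_floor hq₁ hq₁' hp₁ hp₁'.le hs₁ hs₁'.le hx₁
  obtain ⟨_, hxm₂, _, _, _⟩ := chain3_floor hq₂ hq₂' hp₂ hp₂'.le hs₂ hs₂'.le hx₂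
  obtain ⟨_, t0, tM, t1, tmean⟩ := chain3_laws hq₂.le hq₂'.le hp₂.le hp₂'.le hs₂.le hs₂'.le
  have hT : SDEC x 3 (gate CH[p₂, s₂] q₂) := sdec_chain3 hq₂ hq₂' hp₂ hp₂' hs₂ hs₂' hx₂
  have hta : x * ((3 : ℕ) : ℝ) ≤ q₂ * (1 + p₂ + p₂ * s₂) := by push_cast; linarith
  -- component 1: the blob slice
  obtain ⟨B0, BM, B1, Bmean, hB⟩ := sdec_blob3_step hx0 hx1 hxs₁ s1.le t0 tM t1 tmean hta hT
  -- component 2: the far-giant piece beside the second chain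
  obtain ⟨C0, CM, C1, Cmean, hC⟩ := sdec_farPiece_chain hx0 γ0 γ1 hxγ₁ hq₂ hq₂' hp₂ hp₂' hs₂ hs₂' hm₂ hx₂
  have eC : lconv 3 3 (gate CH[p₂, s₂] q₂) CP[(q₁ * (1 + p₁ + p₁ * s₁) - 1) / 2] =
      lconv 3 3 CP[(q₁ * (1 + p₁ + p₁ * s₁) - 1) / 2] (gate CH[p₂, s₂] q₂) := lconv_comm 3 3 _ _
  -- component 3: the light piece beside the second chain (HIGH-CONV)
  have hHi : IsHigh x (2 + (q₁ * (1 + p₁ + p₁ * s₁) - 2)) 3 HP[q₁ * (1 + p₁ + p₁ * s₁) - 2] := isHigh_hp θ0 θ1 hxθ₁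
  have hH : SDEC x (3 + 3) (lconv 3 3 HP[q₁ * (1 + p₁ + p₁ * s₁) - 2] (gate CH[p₂, s₂] q₂)) :=
    sdec_lconv_high hx0 hx1 hHi t0 tM t1 (by rw [tmean]; exact hta) hT
  obtain ⟨g0, _, g1, gmean⟩ := hp_laws θ0 θ1
  obtain ⟨H0, HM, H1, Hmean⟩ := lconv_laws g0 g1 gmean t0 t1 tmean
  have eH : lconv 3 3 (gate CH[p₂, s₂] q₂) HP[q₁ * (1 + p₁ + p₁ * s₁) - 2] = lconv 3 3 HP[q₁ * (1 + p₁ + p₁ * s₁) - 2] (gate CH[p₂, s₂] q₂) :=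
    lconv_comm 3 3 _ _
  -- means
  have eBm : q₂ * (1 + p₂ + p₂ * s₂) + 3 * (q₁ * (1 + p₁ + p₁ * s₁) / 3) = q₂ * (1 + p₂ + p₂ * s₂) + q₁ * (1 + p₁ + p₁ * s₁) := by ring
  have eCm : (1 + 2 * ((q₁ * (1 + p₁ + p₁ * s₁) - 1) / 2)) + q₂ * (1 + p₂ + p₂ * s₂) =
      q₂ * (1 + p₂ + p₂ * s₂) + q₁ * (1 + p₁ + p₁ * s₁) := by ring
  have eHm : (2 + (q₁ * (1 + p₁ + p₁ * s₁) - 2)) + q₂ * (1 + p₂ + p₂ * s₂) = q₂ * (1 + p₂ + p₂ * s₂) + q₁ * (1 + p₁ + p₁ * s₁) := by ring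
  rw [eBm] at Bmean; rw [eCm] at Cmean; rw [eHm] at Hmean
  rw [← eC] at C0 CM C1 Cmean hC
  rw [← eH] at H0 HM H1 Hmean hH
  -- the sub-floor part
  have hN : ∀ h, lconv 3 3 (gate CH[p₂, s₂] q₂) NP[q₁, p₁, s₁] h =
      2 * (1 - p₁) / (2 - p₁ - p₁ * s₁) * lconv 3 3 (gate CH[p₂, s₂] q₂) CP[(q₁ * (1 + p₁ + p₁ * s₁) - 1) / 2] h +
      (1 - 2 * (1 - p₁) / (2 - p₁ - p₁ * s₁)) * lconv 3 3 (gate CH[p₂, s₂] q₂) HP[q₁ * (1 + p₁ + p₁ * s₁) - 2] h := by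
    intro h; rw [bd]; exact lconv_lin_right 3 3 _ _ _ _ _ h
  obtain ⟨N0, NM, N1, Nmean, hNs⟩ := sdec_mix_laws β0 β1 hN C0 CM C1 Cmean H0 HM H1 Hmean hC hH
  exact sdec_mix_laws α0 α1 (fun h => lconv_mix_right 3 3 (gate CH[p₂, s₂] q₂) _ _ _ _ (gate_chain3_eq_mix hq₁ hq₁' hp₁ hp₁' hs₁.le hs₁'.le) h)
    B0 BM B1 Bmean N0 NM N1 Nmean hB hNs

/-! ### The pair hub beside a 3-chain -/

/-- **`(C(γ₁) ∗ C(γ₂)) ∗ t` for a gated 3-chain `t` is SDEC** (floor `0 < x ≤ qps`, `3x ≤ 1+2γᵢ`, `1/2 ≤ γᵢ < 1`, `m ≥ 2`, `s < 1`): the blob slice of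
the pair hub, the triple hub, and the pair hub beside the light piece (HIGH-CONV); with law facts. [this work] -/
theorem sdec_pairHub_chain {x c₁ c₂ q p s : ℝ} (hx0 : 0 < x) (hc₁ : 1 / 2 ≤ c₁) (hc₁' : c₁ < 1) (hc₂ : 1 / 2 ≤ c₂) (hc₂' : c₂ < 1)
    (hxc₁ : 3 * x ≤ 1 + 2 * c₁) (hxc₂ : 3 * x ≤ 1 + 2 * c₂)
    (hq0 : 0 < q) (hq1 : q < 1) (hp0 : 0 < p) (hp1 : p < 1) (hs0 : 0 < s) (hs1 : s < 1) (hm : 2 ≤ q * (1 + p + p * s))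
    (hx : x ≤ q * (p * s)) :
    (∀ h, 0 ≤ lconv (3 + 3) 3 (lconv 3 3 CP[c₁] CP[c₂]) (gate CH[p, s] q) h) ∧
    (∀ h, 3 + 3 + 3 < h → lconv (3 + 3) 3 (lconv 3 3 CP[c₁] CP[c₂]) (gate CH[p, s] q) h = 0) ∧
      ∑ h ∈ Finset.range (3 + 3 + 3 + 1), lconv (3 + 3) 3 (lconv 3 3 CP[c₁] CP[c₂]) (gate CH[p, s] q) h = 1 ∧
      ∑ h ∈ Finset.range (3 + 3 + 3 + 1), (h : ℝ) * lconv (3 + 3) 3 (lconv 3 3 CP[c₁] CP[c₂]) (gate CH[p, s] q) h =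
        ((1 + 2 * c₁) + (1 + 2 * c₂)) + q * (1 + p + p * s) ∧
      SDEC x (3 + 3 + 3) (lconv (3 + 3) 3 (lconv 3 3 CP[c₁] CP[c₂]) (gate CH[p, s] q)) := by
  obtain ⟨_, _, α0, α1, β0, β1, bd, s0, s1, γ0, γ1, θ0, θ1⟩ := chain3_params hq0 hq1 hp0 hp1 hs0 hs1.le hm
  obtain ⟨hx1, hxm, hxs, hxγ, hxθ⟩ := chain3_floor hq0 hq1 hp0 hp1.le hs0 hs1.le hx
  obtain ⟨a0, _, a1, amean⟩ := cp_laws (show (0 : ℝ) ≤ c₁ by linarith) hc₁'.le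
  obtain ⟨b0, _, b1, bmean⟩ := cp_laws (show (0 : ℝ) ≤ c₂ by linarith) hc₂'.le
  obtain ⟨P0, PM, P1, Pmean⟩ := lconv_laws a0 a1 amean b0 b1 bmean
  have hP : SDEC x (3 + 3) (lconv 3 3 CP[c₁] CP[c₂]) := by
    rw [pairHub_eq_lconv]; exact sdec_pairHub hx0 hx1 hc₁ hc₁' hc₂ hc₂' hxc₁ hxc₂
  have hta : x * ((3 + 3 : ℕ) : ℝ) ≤ (1 + 2 * c₁) + (1 + 2 * c₂) := by push_cast; linarith
  -- component 1: the blob slice of the pair hub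
  obtain ⟨B0, BM, B1, Bmean, hB⟩ := sdec_blob3_step hx0 hx1 hxs s1.le P0 PM P1 Pmean hta hP
  -- component 2: the triple hub
  obtain ⟨f0, _, f1, fmean⟩ := cp_laws (show (0 : ℝ) ≤ (q * (1 + p + p * s) - 1) / 2 by linarith) γ1.le
  have hC : SDEC x (3 + 3 + 3) (lconv (3 + 3) 3 (lconv 3 3 CP[c₁] CP[c₂]) CP[(q * (1 + p + p * s) - 1) / 2]) := by
    rw [pairHub_eq_lconv, tripleHub_eq_lconv]; exact sdec_tripleHub hx0 hx1 hc₁ hc₁' hc₂ hc₂' γ0 γ1 hxc₁ hxc₂ hxγ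
  obtain ⟨C0, CM, C1, Cmean⟩ := lconv_laws P0 P1 Pmean f0 f1 fmean
  -- component 3: the pair hub beside the light piece (HIGH-CONV), written with the hub on the left
  have hHi : IsHigh x (2 + (q * (1 + p + p * s) - 2)) 3 HP[q * (1 + p + p * s) - 2] := isHigh_hp θ0 θ1 hxθ
  have hH' : SDEC x (3 + (3 + 3)) (lconv 3 (3 + 3) HP[q * (1 + p + p * s) - 2] (lconv 3 3 CP[c₁] CP[c₂])) :=
    sdec_lconv_high hx0 hx1 hHi P0 PM P1 (by rw [Pmean]; exact hta) hP
  obtain ⟨g0, _, g1, gmean⟩ := hp_laws θ0 θ1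
  obtain ⟨H0, HM, H1, Hmean⟩ := lconv_laws P0 P1 Pmean g0 g1 gmean
  have eH : lconv 3 (3 + 3) HP[q * (1 + p + p * s) - 2] (lconv 3 3 CP[c₁] CP[c₂]) =
      lconv (3 + 3) 3 (lconv 3 3 CP[c₁] CP[c₂]) HP[q * (1 + p + p * s) - 2] := lconv_comm _ _ _ _
  have e9 : (3 + (3 + 3) : ℕ) = 3 + 3 + 3 := by norm_num
  rw [eH, e9] at hH'
  -- means
  have eBm : (1 + 2 * c₁) + (1 + 2 * c₂) + 3 * (q * (1 + p + p * s) / 3) = ((1 + 2 * c₁) + (1 + 2 * c₂)) + q * (1 + p + p * s) := by ring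
  have eCm : (1 + 2 * c₁) + (1 + 2 * c₂) + (1 + 2 * ((q * (1 + p + p * s) - 1) / 2)) =
      ((1 + 2 * c₁) + (1 + 2 * c₂)) + q * (1 + p + p * s) := by ring
  have eHm : (1 + 2 * c₁) + (1 + 2 * c₂) + (2 + (q * (1 + p + p * s) - 2)) = ((1 + 2 * c₁) + (1 + 2 * c₂)) + q * (1 + p + p * s) := by ring
  rw [eBm] at Bmean; rw [eCm] at Cmean; rw [eHm] at Hmean
  have hN : ∀ h, lconv (3 + 3) 3 (lconv 3 3 CP[c₁] CP[c₂]) NP[q, p, s] h =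
      2 * (1 - p) / (2 - p - p * s) * lconv (3 + 3) 3 (lconv 3 3 CP[c₁] CP[c₂]) CP[(q * (1 + p + p * s) - 1) / 2] h +
      (1 - 2 * (1 - p) / (2 - p - p * s)) * lconv (3 + 3) 3 (lconv 3 3 CP[c₁] CP[c₂]) HP[q * (1 + p + p * s) - 2] h := by
    intro h; rw [bd]; exact lconv_lin_right _ _ _ _ _ _ _ h
  obtain ⟨N0, NM, N1, Nmean, hNs⟩ := sdec_mix_laws β0 β1 hN C0 CM C1 Cmean H0 HM H1 Hmean hC hH'
  exact sdec_mix_laws α0 α1 (fun h => lconv_mix_right (3 + 3) 3 _ _ _ _ _ (gate_chain3_eq_mix hq0 hq1 hp0 hp1 hs0.le hs1.le) h)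
    B0 BM B1 Bmean N0 NM N1 Nmean hB hNs

/-! ### Three 3-chains -/

/-- **`C(γ) ∗ (t₂ ∗ t₁)` is SDEC** for two gated 3-chains (floor `0 < x ≤ min qᵢpᵢsᵢ`, `3x ≤ 1+2γ`, `1/2 ≤ γ < 1`): expanding `t₁`, the blob
slice of `C ∗ t₂`, the pair hub `C(γ₁) ∗ C(γ)` beside `t₂`, and the light piece `H₁` beside `C ∗ t₂` (HIGH-CONV); with law facts. [this work] -/
theorem sdec_farPiece_chains2 {x c q₁ p₁ s₁ q₂ p₂ s₂ : ℝ} (hx0 : 0 < x) (hc : 1 / 2 ≤ c) (hc1 : c < 1) (hxc : 3 * x ≤ 1 + 2 * c)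
    (hq₁ : 0 < q₁) (hq₁' : q₁ < 1) (hp₁ : 0 < p₁) (hp₁' : p₁ < 1) (hs₁ : 0 < s₁) (hs₁' : s₁ < 1) (hm₁ : 2 ≤ q₁ * (1 + p₁ + p₁ * s₁))
    (hq₂ : 0 < q₂) (hq₂' : q₂ < 1) (hp₂ : 0 < p₂) (hp₂' : p₂ < 1) (hs₂ : 0 < s₂) (hs₂' : s₂ < 1) (hm₂ : 2 ≤ q₂ * (1 + p₂ + p₂ * s₂))
    (hx₁ : x ≤ q₁ * (p₁ * s₁)) (hx₂ : x ≤ q₂ * (p₂ * s₂)) :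
    (∀ h, 0 ≤ lconv 3 (3 + 3) CP[c] (lconv 3 3 (gate CH[p₂, s₂] q₂) (gate CH[p₁, s₁] q₁)) h) ∧
    (∀ h, 3 + (3 + 3) < h → lconv 3 (3 + 3) CP[c] (lconv 3 3 (gate CH[p₂, s₂] q₂) (gate CH[p₁, s₁] q₁)) h = 0) ∧
      ∑ h ∈ Finset.range (3 + (3 + 3) + 1), lconv 3 (3 + 3) CP[c] (lconv 3 3 (gate CH[p₂, s₂] q₂) (gate CH[p₁, s₁] q₁)) h = 1 ∧
      ∑ h ∈ Finset.range (3 + (3 + 3) + 1), (h : ℝ) * lconv 3 (3 + 3) CP[c] (lconv 3 3 (gate CH[p₂, s₂] q₂) (gate CH[p₁, s₁] q₁)) h =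
        (1 + 2 * c) + (q₂ * (1 + p₂ + p₂ * s₂) + q₁ * (1 + p₁ + p₁ * s₁)) ∧
      SDEC x (3 + (3 + 3)) (lconv 3 (3 + 3) CP[c] (lconv 3 3 (gate CH[p₂, s₂] q₂) (gate CH[p₁, s₁] q₁))) := by
  obtain ⟨_, _, α0, α1, β0, β1, bd, s0, s1, γ0, γ1, θ0, θ1⟩ := chain3_params hq₁ hq₁' hp₁ hp₁' hs₁ hs₁'.le hm₁
  obtain ⟨hx1, hxm₁, hxs₁, hxγ₁, hxθ₁⟩ := chain3_floor hq₁ hq₁' hp₁ hp₁'.le hs₁ hs₁'.le hx₁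
  obtain ⟨_, hxm₂, _, _, _⟩ := chain3_floor hq₂ hq₂' hp₂ hp₂'.le hs₂ hs₂'.le hx₂
  obtain ⟨c0, _, c1, cmean⟩ := cp_laws (show (0 : ℝ) ≤ c by linarith) hc1.le
  -- the core `C ∗ t₂`
  obtain ⟨K0, KM, K1, Kmean, hK⟩ := sdec_farPiece_chain hx0 hc hc1 hxc hq₂ hq₂' hp₂ hp₂' hs₂ hs₂' hm₂ hx₂
  have htaK : x * ((3 + 3 : ℕ) : ℝ) ≤ (1 + 2 * c) + q₂ * (1 + p₂ + p₂ * s₂) := by push_cast; linarith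
  -- (i) its blob slice
  obtain ⟨P0, PM, P1, Pmean, hP⟩ := sdec_blob3_step hx0 hx1 hxs₁ s1.le K0 KM K1 Kmean htaK hK
  have eP : lconv (3 + 3) 3 (lconv 3 3 CP[c] (gate CH[p₂, s₂] q₂)) (gate δ[3] (q₁ * (1 + p₁ + p₁ * s₁) / 3)) =
      lconv 3 (3 + 3) CP[c] (lconv 3 3 (gate CH[p₂, s₂] q₂) (gate δ[3] (q₁ * (1 + p₁ + p₁ * s₁) / 3))) := by rw [← lconv_assoc]
  rw [eP] at P0 PM P1 Pmean hP
  -- (ii) the pair hub `C(γ₁) ∗ C(γ)` beside `t₂`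
  obtain ⟨S0, SM, S1, Smean, hS⟩ := sdec_pairHub_chain hx0 γ0 γ1 hc hc1 hxγ₁ hxc hq₂ hq₂' hp₂ hp₂' hs₂ hs₂' hm₂ hx₂
  have eS : lconv (3 + 3) 3 (lconv 3 3 CP[(q₁ * (1 + p₁ + p₁ * s₁) - 1) / 2] CP[c]) (gate CH[p₂, s₂] q₂) =
      lconv 3 (3 + 3) CP[c] (lconv 3 3 (gate CH[p₂, s₂] q₂) CP[(q₁ * (1 + p₁ + p₁ * s₁) - 1) / 2]) := by
    rw [lconv_comm 3 3 CP[(q₁ * (1 + p₁ + p₁ * s₁) - 1) / 2] CP[c], ← lconv_assoc, lconv_comm 3 3 CP[(q₁ * (1 + p₁ + p₁ * s₁) - 1) / 2]]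
  have e9 : (3 + 3 + 3 : ℕ) = 3 + (3 + 3) := by norm_num
  rw [eS] at S0 SM S1 Smean hS
  rw [e9] at SM S1 Smean hS
  -- (iii) the light piece `H₁` beside the core (HIGH-CONV)
  have hHi : IsHigh x (2 + (q₁ * (1 + p₁ + p₁ * s₁) - 2)) 3 HP[q₁ * (1 + p₁ + p₁ * s₁) - 2] := isHigh_hp θ0 θ1 hxθ₁
  have hH' : SDEC x (3 + (3 + 3)) (lconv 3 (3 + 3) HP[q₁ * (1 + p₁ + p₁ * s₁) - 2] (lconv 3 3 CP[c] (gate CH[p₂, s₂] q₂))) :=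
    sdec_lconv_high hx0 hx1 hHi K0 KM K1 (by rw [Kmean]; exact htaK) hK
  obtain ⟨g0, _, g1, gmean⟩ := hp_laws θ0 θ1
  obtain ⟨H0, HM, H1, Hmean⟩ := lconv_laws g0 g1 gmean K0 K1 Kmean
  have eH : lconv 3 (3 + 3) HP[q₁ * (1 + p₁ + p₁ * s₁) - 2] (lconv 3 3 CP[c] (gate CH[p₂, s₂] q₂)) =
      lconv 3 (3 + 3) CP[c] (lconv 3 3 (gate CH[p₂, s₂] q₂) HP[q₁ * (1 + p₁ + p₁ * s₁) - 2]) := by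
    rw [lconv_comm 3 (3 + 3) HP[q₁ * (1 + p₁ + p₁ * s₁) - 2], ← lconv_assoc]
  rw [eH] at H0 HM H1 Hmean hH'
  -- means
  have ePm : (1 + 2 * c) + q₂ * (1 + p₂ + p₂ * s₂) + 3 * (q₁ * (1 + p₁ + p₁ * s₁) / 3) =
      (1 + 2 * c) + (q₂ * (1 + p₂ + p₂ * s₂) + q₁ * (1 + p₁ + p₁ * s₁)) := by ring
  have eSm : ((1 + 2 * ((q₁ * (1 + p₁ + p₁ * s₁) - 1) / 2)) + (1 + 2 * c)) + q₂ * (1 + p₂ + p₂ * s₂) =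
      (1 + 2 * c) + (q₂ * (1 + p₂ + p₂ * s₂) + q₁ * (1 + p₁ + p₁ * s₁)) := by ring
  have eHm : (2 + (q₁ * (1 + p₁ + p₁ * s₁) - 2)) + ((1 + 2 * c) + q₂ * (1 + p₂ + p₂ * s₂)) =
      (1 + 2 * c) + (q₂ * (1 + p₂ + p₂ * s₂) + q₁ * (1 + p₁ + p₁ * s₁)) := by ring
  rw [ePm] at Pmean; rw [eSm] at Smean; rw [eHm] at Hmean
  -- inner mixture over the sub-floor part of `t₁`, outer over its blob
  have hF : ∀ h, lconv 3 3 (gate CH[p₂, s₂] q₂) NP[q₁, p₁, s₁] h =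
      2 * (1 - p₁) / (2 - p₁ - p₁ * s₁) * lconv 3 3 (gate CH[p₂, s₂] q₂) CP[(q₁ * (1 + p₁ + p₁ * s₁) - 1) / 2] h +
      (1 - 2 * (1 - p₁) / (2 - p₁ - p₁ * s₁)) * lconv 3 3 (gate CH[p₂, s₂] q₂) HP[q₁ * (1 + p₁ + p₁ * s₁) - 2] h := by
    intro h; rw [bd]; exact lconv_lin_right _ _ _ _ _ _ _ h
  obtain ⟨N0, NM, N1, Nmean, hNs⟩ := sdec_mix_laws β0 β1 (fun h => lconv_mix_right 3 (3 + 3) CP[c] _ _ _ _ hF h)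
    S0 SM S1 Smean H0 HM H1 Hmean hS hH'
  have hmix : ∀ h, lconv 3 3 (gate CH[p₂, s₂] q₂) (gate CH[p₁, s₁] q₁) h =
      3 * (1 - q₁) / (3 - q₁ * (1 + p₁ + p₁ * s₁)) * lconv 3 3 (gate CH[p₂, s₂] q₂) (gate δ[3] (q₁ * (1 + p₁ + p₁ * s₁) / 3)) h +
      (1 - 3 * (1 - q₁) / (3 - q₁ * (1 + p₁ + p₁ * s₁))) * lconv 3 3 (gate CH[p₂, s₂] q₂) NP[q₁, p₁, s₁] h :=
    fun h => lconv_mix_right 3 3 _ _ _ _ _ (gate_chain3_eq_mix hq₁ hq₁' hp₁ hp₁' hs₁.le hs₁'.le) h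
  exact sdec_mix_laws α0 α1 (fun h => lconv_mix_right 3 (3 + 3) CP[c] _ _ _ _ hmix h) P0 PM P1 Pmean N0 NM N1 Nmean hP hNs

/-- **THREE 3-CHAINS ARE SDEC AT THE TRUE FLOOR, ORACLE-FREE.**  For `i = 1,2,3`: `0 < qᵢ, pᵢ, sᵢ < 1`, `mᵢ = qᵢ(1+pᵢ+pᵢsᵢ) ≥ 2`, and every
floor `0 < x ≤ min qᵢpᵢsᵢ` (⊇ all tree-OK floors): the forest law `t₃ ∗ t₂ ∗ t₁` of the three 3-chains `R[qᵢ](R[pᵢ](R[sᵢ]))` is `SDEC x 9`, with its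
law facts.  (The glued-children instance `sᵢ = 1` is `sdec_gluedChildren3`.) [this work] -/
theorem sdec_chains3 {x q₁ p₁ s₁ q₂ p₂ s₂ q₃ p₃ s₃ : ℝ} (hx0 : 0 < x)
    (hq₁ : 0 < q₁) (hq₁' : q₁ < 1) (hp₁ : 0 < p₁) (hp₁' : p₁ < 1) (hs₁ : 0 < s₁) (hs₁' : s₁ < 1) (hm₁ : 2 ≤ q₁ * (1 + p₁ + p₁ * s₁))
    (hq₂ : 0 < q₂) (hq₂' : q₂ < 1) (hp₂ : 0 < p₂) (hp₂' : p₂ < 1) (hs₂ : 0 < s₂) (hs₂' : s₂ < 1) (hm₂ : 2 ≤ q₂ * (1 + p₂ + p₂ * s₂))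
    (hq₃ : 0 < q₃) (hq₃' : q₃ < 1) (hp₃ : 0 < p₃) (hp₃' : p₃ < 1) (hs₃ : 0 < s₃) (hs₃' : s₃ < 1) (hm₃ : 2 ≤ q₃ * (1 + p₃ + p₃ * s₃))
    (hx₁ : x ≤ q₁ * (p₁ * s₁)) (hx₂ : x ≤ q₂ * (p₂ * s₂)) (hx₃ : x ≤ q₃ * (p₃ * s₃)) :
    (∀ h, 0 ≤ lconv (3 + 3) 3 (lconv 3 3 (gate CH[p₃, s₃] q₃) (gate CH[p₂, s₂] q₂)) (gate CH[p₁, s₁] q₁) h) ∧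
    (∀ h, 3 + 3 + 3 < h → lconv (3 + 3) 3 (lconv 3 3 (gate CH[p₃, s₃] q₃) (gate CH[p₂, s₂] q₂)) (gate CH[p₁, s₁] q₁) h = 0) ∧
      ∑ h ∈ Finset.range (3 + 3 + 3 + 1), lconv (3 + 3) 3 (lconv 3 3 (gate CH[p₃, s₃] q₃) (gate CH[p₂, s₂] q₂)) (gate CH[p₁, s₁] q₁) h = 1 ∧
      ∑ h ∈ Finset.range (3 + 3 + 3 + 1),
        (h : ℝ) * lconv (3 + 3) 3 (lconv 3 3 (gate CH[p₃, s₃] q₃) (gate CH[p₂, s₂] q₂)) (gate CH[p₁, s₁] q₁) h =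
        q₃ * (1 + p₃ + p₃ * s₃) + q₂ * (1 + p₂ + p₂ * s₂) + q₁ * (1 + p₁ + p₁ * s₁) ∧
      SDEC x (3 + 3 + 3) (lconv (3 + 3) 3 (lconv 3 3 (gate CH[p₃, s₃] q₃) (gate CH[p₂, s₂] q₂)) (gate CH[p₁, s₁] q₁)) := by
  obtain ⟨_, _, α0, α1, β0, β1, bd, s0, s1, γ0, γ1, θ0, θ1⟩ := chain3_params hq₁ hq₁' hp₁ hp₁' hs₁ hs₁'.le hm₁
  obtain ⟨hx1, hxm₁, hxs₁, hxγ₁, hxθ₁⟩ := chain3_floor hq₁ hq₁' hp₁ hp₁'.le hs₁ hs₁'.le hx₁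
  obtain ⟨_, hxm₂, _, _, _⟩ := chain3_floor hq₂ hq₂' hp₂ hp₂'.le hs₂ hs₂'.le hx₂
  obtain ⟨_, hxm₃, _, _, _⟩ := chain3_floor hq₃ hq₃' hp₃ hp₃'.le hs₃ hs₃'.le hx₃
  -- the width-2 forest `t₃ ∗ t₂`
  obtain ⟨F0, FM, F1, Fmean, hF⟩ := sdec_chains2 hx0 hq₂ hq₂' hp₂ hp₂' hs₂ hs₂' hm₂ hq₃ hq₃' hp₃ hp₃' hs₃ hs₃' hm₃ hx₂ hx₃
  have htaF : x * ((3 + 3 : ℕ) : ℝ) ≤ q₃ * (1 + p₃ + p₃ * s₃) + q₂ * (1 + p₂ + p₂ * s₂) := by push_cast; linarith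
  -- component 1: its blob slice
  obtain ⟨P0, PM, P1, Pmean, hP⟩ := sdec_blob3_step hx0 hx1 hxs₁ s1.le F0 FM F1 Fmean htaF hF
  -- component 2: the far-giant piece of the first chain beside the forest
  obtain ⟨S0, SM, S1, Smean, hS⟩ :=
    sdec_farPiece_chains2 hx0 γ0 γ1 hxγ₁ hq₂ hq₂' hp₂ hp₂' hs₂ hs₂' hm₂ hq₃ hq₃' hp₃ hp₃' hs₃ hs₃' hm₃ hx₂ hx₃
  have eS : lconv 3 (3 + 3) CP[(q₁ * (1 + p₁ + p₁ * s₁) - 1) / 2] (lconv 3 3 (gate CH[p₃, s₃] q₃) (gate CH[p₂, s₂] q₂)) =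
      lconv (3 + 3) 3 (lconv 3 3 (gate CH[p₃, s₃] q₃) (gate CH[p₂, s₂] q₂)) CP[(q₁ * (1 + p₁ + p₁ * s₁) - 1) / 2] := lconv_comm _ _ _ _
  have e9 : (3 + (3 + 3) : ℕ) = 3 + 3 + 3 := by norm_num
  rw [eS] at S0 SM S1 Smean hS
  rw [e9] at SM S1 Smean hS
  -- component 3: the light piece of the first chain beside the forest (HIGH-CONV)
  have hHi : IsHigh x (2 + (q₁ * (1 + p₁ + p₁ * s₁) - 2)) 3 HP[q₁ * (1 + p₁ + p₁ * s₁) - 2] := isHigh_hp θ0 θ1 hxθ₁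
  have hH' : SDEC x (3 + (3 + 3)) (lconv 3 (3 + 3) HP[q₁ * (1 + p₁ + p₁ * s₁) - 2] (lconv 3 3 (gate CH[p₃, s₃] q₃) (gate CH[p₂, s₂] q₂))) :=
    sdec_lconv_high hx0 hx1 hHi F0 FM F1 (by rw [Fmean]; exact htaF) hF
  obtain ⟨g0, _, g1, gmean⟩ := hp_laws θ0 θ1
  obtain ⟨H0, HM, H1, Hmean⟩ := lconv_laws F0 F1 Fmean g0 g1 gmean
  have eH : lconv 3 (3 + 3) HP[q₁ * (1 + p₁ + p₁ * s₁) - 2] (lconv 3 3 (gate CH[p₃, s₃] q₃) (gate CH[p₂, s₂] q₂)) =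
      lconv (3 + 3) 3 (lconv 3 3 (gate CH[p₃, s₃] q₃) (gate CH[p₂, s₂] q₂)) HP[q₁ * (1 + p₁ + p₁ * s₁) - 2] := lconv_comm _ _ _ _
  rw [eH, e9] at hH'
  -- means
  have ePm : q₃ * (1 + p₃ + p₃ * s₃) + q₂ * (1 + p₂ + p₂ * s₂) + 3 * (q₁ * (1 + p₁ + p₁ * s₁) / 3) =
      q₃ * (1 + p₃ + p₃ * s₃) + q₂ * (1 + p₂ + p₂ * s₂) + q₁ * (1 + p₁ + p₁ * s₁) := by ring
  have eSm : (1 + 2 * ((q₁ * (1 + p₁ + p₁ * s₁) - 1) / 2)) + (q₃ * (1 + p₃ + p₃ * s₃) + q₂ * (1 + p₂ + p₂ * s₂)) =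
      q₃ * (1 + p₃ + p₃ * s₃) + q₂ * (1 + p₂ + p₂ * s₂) + q₁ * (1 + p₁ + p₁ * s₁) := by ring
  have eHm : q₃ * (1 + p₃ + p₃ * s₃) + q₂ * (1 + p₂ + p₂ * s₂) + (2 + (q₁ * (1 + p₁ + p₁ * s₁) - 2)) =
      q₃ * (1 + p₃ + p₃ * s₃) + q₂ * (1 + p₂ + p₂ * s₂) + q₁ * (1 + p₁ + p₁ * s₁) := by ring
  rw [ePm] at Pmean; rw [eSm] at Smean; rw [eHm] at Hmean
  have hN : ∀ h, lconv (3 + 3) 3 (lconv 3 3 (gate CH[p₃, s₃] q₃) (gate CH[p₂, s₂] q₂)) NP[q₁, p₁, s₁] h =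
      2 * (1 - p₁) / (2 - p₁ - p₁ * s₁) *
        lconv (3 + 3) 3 (lconv 3 3 (gate CH[p₃, s₃] q₃) (gate CH[p₂, s₂] q₂)) CP[(q₁ * (1 + p₁ + p₁ * s₁) - 1) / 2] h +
      (1 - 2 * (1 - p₁) / (2 - p₁ - p₁ * s₁)) *
        lconv (3 + 3) 3 (lconv 3 3 (gate CH[p₃, s₃] q₃) (gate CH[p₂, s₂] q₂)) HP[q₁ * (1 + p₁ + p₁ * s₁) - 2] h := by
    intro h; rw [bd]; exact lconv_lin_right _ _ _ _ _ _ _ h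
  obtain ⟨N0, NM, N1, Nmean, hNs⟩ := sdec_mix_laws β0 β1 hN S0 SM S1 Smean H0 HM H1 Hmean hS hH'
  exact sdec_mix_laws α0 α1 (fun h => lconv_mix_right (3 + 3) 3 _ _ _ _ _ (gate_chain3_eq_mix hq₁ hq₁' hp₁ hp₁' hs₁.le hs₁'.le) h)
    P0 PM P1 Pmean N0 NM N1 Nmean hP hNs

end LawDec
end Quant
end Summit.CriticalPhenomena.PercolationContinuityZ3.Theorems
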